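import Literature.AlgebraicGeometry.GroupSchemes.BarsottiTateGroupQuotientMaps
import Literature.AlgebraicGeometry.AbelianSchemes.PDivisibleGroupOfAbelianScheme
import Literature.AlgebraicGeometry.AbelianSchemes.IsMonHomOfCompFaithfullyFlat
import Literature.AlgebraicGeometry.Morphisms.FpqcDescentOfMorphisms
import Literature.AlgebraicGeometry.Morphisms.ClosedImmersionOfEqualRank
import Literature.AlgebraicGeometry.GroupSchemes.SubPinCompCoverClosedImmersion
import Literature.AlgebraicGeometry.GroupSchemes.SerreTateStabilisationTrivialKernel
import HarnessLib

/-!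
# Descent of morphisms along the quotient maps `[p^{m−n}] : G m ↠ G n` of a Barsotti–Tate group, and the recognition of a
# torsion-layer embedding `G n ≅ X[N]` by rank ([Tate1967] §2 (2.1), (2.4); [Katz1981SerreTate] §1.2, proof of Thm. 1.2.1)

Topic `Literature/AlgebraicGeometry/GroupSchemes`; namespaces `Literature.AlgebraicGeometry.GroupSchemes.BTGroup` (§1) and
`Literature.AlgebraicGeometry.AbelianSchemes.AbelianSchemeOver` (§2–§3).  THEOREMS ONLY (no definition, no named fact, no instance, no notation,
no `sorry`).  Cell `hodgecm-mathlib` (D-0151 ∕ D-0183 FLOOR 0), P6 Row 4B «σ2», socket E3 «TOWER» of `Cruxes/HLiu418/Lines/F0_P6b_SerreTateSigma2.lean`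
(`stub_L4B1esT_torsionTowerOfQuotient`: «the quotient `X = Y⧸Z` has `p`-divisible group `B`, `iX n` = descent of `β (n+2) ≫ π` along `[p²]`»),
organ seat P6b-A4 (desk F0P6b-plan (g13), prover LA1-p02 (g10)); generic, count-neutral capital on `--supports stmt-HodgeConjecture-24832`.  HC_CM is
proved only modulo the printed citations until rung 0 closes; nothing here is about HC.

THE PRINT.  [Tate1967] §2 (2.1): the sequences `0 → G_{m−n} →(i) G_m →(j) G_n → 0` of a `p`-divisible group are exact, `j ∘ i = p^{m−n}` — in
fppf language `j = [p^{m−n}] : G_m ↠ G_n` is an EFFECTIVE EPIMORPHISM with kernel `G_{m−n}`, so a morphism out of `G_m` which is constant on the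
fibres of `j` DESCENDS uniquely to `G_n` ([SGA1] VIII ∕ [GortzWedhorn2020] Thm. 14.72, fpqc descent of morphisms; the tree's ★
`Morphisms/FpqcDescentOfMorphisms`).  [Tate1967] §2 (2.4) ∕ [Katz1981SerreTate] proof of Thm. 1.2.1 (p. 142): the `p`-divisible group of an abelian
scheme `X` of relative dimension `g` has layers `X[pⁿ]`, finite locally free of rank `p^{2gn}`; a MONOMORPHIC homomorphism `G_n ↪ X[pⁿ]` from a layer of a
Barsotti–Tate group of height `2g` is therefore an ISOMORPHISM (a closed immersion of finite flat schemes of equal rank, [StacksProject] Tag 02KA).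

* §1 `existsUnique_desc_of_comp_transition_eq_pow` — for ANY `q : G m ⟶ G n` with `q ≫ i_{n,m} = [p^{m−n}]` (★ `BarsottiTateGroupQuotientMaps`: flat,
  surjective, finite) and any `f : G m ⟶ X` over `S = Spec A` constant on the fibres of `q` (`a ≫ q = b ≫ q → a ≫ f = b ≫ f` on `T`-points), there is a
  UNIQUE `g : G n ⟶ X` with `q ≫ g = f`; `isMonHom_desc_of_comp_transition_eq_pow` — if `f` is a homomorphism, so is `g` (★ `isMonHom_of_comp_of_flat_surjective`).
* §2 `comp_mulN_eq_one_of_id_pow_eq_one` — a homomorphism out of an `N`-torsion group object is killed by `[N]` of the abelian target, hence factors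
  through `X[N]` (★ `torsionLift`) as a HOMOMORPHISM (`isMonHom_torsionLift`, ★ `GroupSchemeKernel.isMonHom_kerLift`).
* §3 `Over.isIso_of_mono_of_finrank_eq` — a monomorphism of finite flat `S`-schemes of equal rank is an isomorphism (finite + mono ⇒ closed immersion, ★
  `isClosedImmersion_left_of_isFinite_of_mono`; equal rank, ★ `Over.isIso_of_isClosedImmersion_of_finrank_eq`); `isIso_of_mono_btGroup_torsion` — the case
  `G n ↪ X[pⁿ]`, ranks `p^{n·2g} = (pⁿ)^{2g}` (★ `BTGroup.finrank_eq`, ★ `finrank_torsion_hom`); `isPullback_comp_torsionι_of_isIso` — an isomorphism onto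
  `X[N]` followed by `ι` is a KERNEL of `[N] = (𝟙 X)^N` (the cartesian square of the «torsion tower» predicate).

NOT here (the E3 junction, HOME sub-line): the fibre-constancy of `β (n+2) ≫ π` (kernel `B[p²]` of `[p²]` is killed because `β (n+2) ∘ incl² = β 2 = b ≫ iZ`
and `iZ ≫ π = 1`), the MONO clause of the descended map (Drinfeld's STABILISATION «`Ker β_{n+2} ⊆ B[p²]`», Messing-free ★ `BTGroup.pow_sq_eq_one_of_comp_betaLift_eq_one`),
and the tower compatibility.

## References
* [Tate1967] J. Tate, *p-divisible groups*, Proc. Conf. Local Fields (Driebergen 1966), Springer (1967), §2 (2.1) (pp. 161–162), (2.4).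
* [Katz1981SerreTate] N. Katz, *Serre–Tate local moduli*, LNM 868 (1981), Exp. V-bis, §1.2, proof of Thm. 1.2.1 (p. 142).
* [GortzWedhorn2020] U. Görtz, T. Wedhorn, *Algebraic Geometry I* (2nd ed., 2020), Thm. 14.72 (fpqc descent of morphisms), Def. 4.45 (2).
* [StacksProject] The Stacks Project, Tag 02KA (rank of a finite locally free morphism), Tag 023Q (descent of morphisms).
-/

noncomputable section

-- Mathlib's `Over`/pull-back API is stated across semireducible wrappers (as in the ★ `GroupSchemes/*` files).
set_option backward.isDefEq.respectTransparency false

universe u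

open CategoryTheory CategoryTheory.Limits AlgebraicGeometry MonoidalCategory CartesianMonoidalCategory
open scoped MonObj

namespace Literature.AlgebraicGeometry.GroupSchemes

namespace BTGroup

variable {p h : ℕ}

/-! ## §1 Descent of morphisms along `q = [p^{m−n}] : G m ↠ G n` -/

/-- **DESCENT ALONG THE QUOTIENT MAP OF A BARSOTTI–TATE GROUP.**  `B` a Barsotti–Tate group over `S = Spec A`, `n ≤ m`, `q : G m ⟶ G n` ANY map with
`q ≫ i_{n,m} = [p^{m−n}]` (so `q` is the iterated `[p]`-map: a flat surjective finite homomorphism, ★ `BarsottiTateGroupQuotientMaps`); `f : G m ⟶ X` a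
morphism over `S` which is CONSTANT ON THE FIBRES of `q` («`a ≫ q = b ≫ q ⇒ a ≫ f = b ≫ f`» for all `T`-points `a`, `b`).  THEN `f` descends UNIQUELY:
`∃! g : G n ⟶ X, q ≫ g = f` — fpqc descent of morphisms along the fpqc cover `q.left` (★ `SchemeOver.existsUnique_desc_of_pullback_comp_eq`; the
kernel-pair hypothesis is the fibre-constancy at the `T`-point pair `(pr₁, pr₂)` of `G m ×_{G n} G m`). [cite: Tate1967, §2 (2.1) (pp. 161–162)]
[cite: GortzWedhorn2020, Theorem 14.72] [cite: StacksProject, Tag 023Q] -/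
theorem existsUnique_desc_of_comp_transition_eq_pow {A : Type u} [CommRing A] (B : BTGroup (Spec (.of A)) p h) {n m : ℕ} (hnm : n ≤ m)
    (q : B.G m ⟶ B.G n) (hq : letI := B.grpObj m; q ≫ B.transition hnm = (𝟙 (B.G m)) ^ (p ^ (m - n)))
    (X : Over (Spec (.of A))) (f : B.G m ⟶ X)
    (hf : ∀ (T : Over (Spec (.of A))) (a b : T ⟶ B.G m), a ≫ q = b ≫ q → a ≫ f = b ≫ f) :
    ∃! g : B.G n ⟶ X, q ≫ g = f := by
  haveI := B.flat_left_of_comp_transition_eq_pow hnm hq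
  haveI := B.surjective_left_of_comp_transition_eq_pow hnm hq
  haveI : IsAffine (B.G m).left := haveI := B.isFinite m; isAffine_of_isAffineHom (B.G m).hom
  haveI : IsAffine (B.G n).left := haveI := B.isFinite n; isAffine_of_isAffineHom (B.G n).hom
  have hh : pullback.fst q.left q.left ≫ f.left = pullback.snd q.left q.left ≫ f.left := by
    have hw : pullback.snd q.left q.left ≫ (B.G m).hom = (pullback.fst q.left q.left ≫ (B.G m).hom : _ ⟶ Spec (.of A)) := by
      rw [← Over.w q, ← Category.assoc, ← pullback.condition, Category.assoc]
    let T : Over (Spec (.of A)) := Over.mk (pullback.fst q.left q.left ≫ (B.G m).hom)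
    let a : T ⟶ B.G m := Over.homMk (pullback.fst q.left q.left) rfl
    let b : T ⟶ B.G m := Over.homMk (pullback.snd q.left q.left) hw
    have hab : a ≫ q = b ≫ q := Over.OverMorphism.ext pullback.condition
    exact congrArg (fun φ => φ.left) (hf T a b hab)
  exact Literature.AlgebraicGeometry.Morphisms.SchemeOver.existsUnique_desc_of_pullback_comp_eq q f hh

/-- **THE DESCENDED MORPHISM IS A HOMOMORPHISM** when `f` is: `q` is a flat surjective homomorphism, so the unit and law clauses of `g` may be checked
after composing with the epimorphisms `q`, `q ⊗ q` (★ `isMonHom_of_comp_of_flat_surjective`). [cite: Tate1967, §2 (2.1) (pp. 161–162)]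
[cite: GortzWedhorn2020, Theorem 14.72] -/
theorem isMonHom_desc_of_comp_transition_eq_pow {S : Scheme.{u}} (B : BTGroup S p h) {n m : ℕ} (hnm : n ≤ m)
    {q : B.G m ⟶ B.G n} (hq : letI := B.grpObj m; q ≫ B.transition hnm = (𝟙 (B.G m)) ^ (p ^ (m - n)))
    {X : Over S} [MonObj X] (f : B.G m ⟶ X) (hf : letI := B.grpObj m; IsMonHom f) (g : B.G n ⟶ X) (hg : q ≫ g = f) :
    letI := B.grpObj n; IsMonHom g := by
  letI := B.grpObj n; letI := B.grpObj m
  haveI := B.isMonHom_of_comp_transition_eq_pow hnm hq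
  haveI := B.flat_left_of_comp_transition_eq_pow hnm hq
  haveI := B.surjective_left_of_comp_transition_eq_pow hnm hq
  subst hg
  exact Literature.AlgebraicGeometry.AbelianSchemes.isMonHom_of_comp_of_flat_surjective (π := q) g hf

end BTGroup

end Literature.AlgebraicGeometry.GroupSchemes

namespace Literature.AlgebraicGeometry.AbelianSchemes

namespace AbelianSchemeOver

open Literature.AlgebraicGeometry.GroupSchemes

variable {S : Scheme.{u}} (A : AbelianSchemeOver S)

/-! ## §2 A homomorphism out of an `N`-torsion group object factors through `X[N]` as a homomorphism -/

/-- **A homomorphism `g : G ⟶ X` out of a group object KILLED BY `N` (`(𝟙 G)^N = 1`) is killed by `[N]_X`**: `g ≫ [N] = g^N = ((𝟙 G)^N) ≫ g = 1` —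
so it factors through the `N`-torsion `X[N]` (★ `torsionLift`).  (For a layer `G n` of a Barsotti–Tate group: `(𝟙 (G n))^{pⁿ} = 1` is the carrier's
axiom ★ `BTGroup.killed`.) [cite: Tate1967, §2 (2.1) (pp. 161–162)] -/
theorem comp_mulN_eq_one_of_id_pow_eq_one {G : Over S} [MonObj G] {N : ℕ} (hG : (𝟙 G) ^ N = 1) (g : G ⟶ A.X) [IsMonHom g] :
    g ≫ A.mulN N = 1 := by
  rw [A.comp_mulN]
  calc g ^ N = ((𝟙 G) ≫ g) ^ N := by rw [Category.id_comp]
    _ = ((𝟙 G) ^ N) ≫ g := (MonObj.pow_comp _ _ _).symm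
    _ = 1 := by rw [hG, MonObj.one_comp]

/-- **The lift `G ⟶ X[N]` of a homomorphism killed by `[N]` is a HOMOMORPHISM** (`X` commutative, so `X[N]` is a group scheme, ★ `torsionGrpObj`;
★ `GroupSchemeKernel.isMonHom_kerLift`). [cite: Tate1967, §2 (2.1) (pp. 161–162)] -/
theorem isMonHom_torsionLift [IsCommMonObj A.X] {G : Over S} [MonObj G] {N : ℕ} (g : G ⟶ A.X) [IsMonHom g] (hg : g ≫ A.mulN N = 1) :
    letI := A.torsionGrpObj N; IsMonHom (A.torsionLift g hg) := by
  letI := A.torsionGrpObj N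
  haveI := A.isMonHom_mulN N
  exact GroupSchemeKernel.isMonHom_kerLift (f := A.mulN N) g hg

/-! ## §3 Recognition of a torsion-layer embedding by rank -/

/-- **EQUAL-RANK RIGIDITY FOR MONOMORPHISMS**: a monomorphism `c : H ⟶ G` of `S`-schemes with `H`, `G` finite and flat over `S` OF THE SAME RANK at
every point of `S` is an ISOMORPHISM — `c.left` is finite (`H → S` finite, `G → S` separated), a monomorphism, hence a closed immersion (★
`isClosedImmersion_left_of_isFinite_of_mono`), of finite flat schemes of equal rank (★ `Over.isIso_of_isClosedImmersion_of_finrank_eq`).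
[cite: StacksProject, Tag 02KA] -/
theorem _root_.Literature.AlgebraicGeometry.Morphisms.Over.isIso_of_mono_of_finrank_eq {G H : Over S} (c : H ⟶ G) [Mono c]
    [IsFinite H.hom] [Flat H.hom] [IsFinite G.hom] [Flat G.hom] (h : ∀ s, H.hom.finrank s = G.hom.finrank s) : IsIso c := by
  haveI : IsFinite (c.left ≫ G.hom) := by rw [Over.w c]; infer_instance
  haveI : IsFinite c.left := IsFinite.of_comp c.left G.hom
  haveI : IsClosedImmersion c.left := Literature.AlgebraicGeometry.GroupSchemes.IdealKernelLayerMap.isClosedImmersion_left_of_isFinite_of_mono c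
  exact Literature.AlgebraicGeometry.Morphisms.Over.isIso_of_isClosedImmersion_of_finrank_eq c h

/-- **A MONOMORPHISM `G n ↪ X[pⁿ]` FROM A LAYER OF A BARSOTTI–TATE GROUP OF HEIGHT `2g` INTO THE `pⁿ`-TORSION OF AN ABELIAN SCHEME OF RELATIVE DIMENSION
`g` IS AN ISOMORPHISM**: both are finite flat over `S` of rank `p^{2gn}` (★ `BTGroup.finrank_eq`, ★ `finrank_torsion_hom`).  [Tate1967] §2 (2.4) ∕ [Katz1981SerreTate]
proof of Thm. 1.2.1: «`A[p^∞] ≅ B[p^∞]⧸K ≅ G`» once the comparison map is known to be injective.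
[cite: Tate1967, §2 (2.1) (pp. 161–162)] [cite: Katz1981SerreTate, proof of Theorem 1.2.1 (§1.2, p. 142)] [cite: StacksProject, Tag 02KA] -/
theorem isIso_of_mono_btGroup_torsion {p g : ℕ} (hp : p ≠ 0) (hg : A.IsOfRelDim g) (B : BTGroup S p (2 * g)) (n : ℕ)
    (j : B.G n ⟶ A.torsion (p ^ n)) [Mono j] : IsIso j := by
  haveI := B.isFinite n
  haveI := B.flat n
  haveI := A.isFinite_torsion_hom (pow_ne_zero n hp)
  haveI := A.flat_torsion_hom (pow_ne_zero n hp)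
  refine Literature.AlgebraicGeometry.Morphisms.Over.isIso_of_mono_of_finrank_eq j fun s => ?_
  rw [B.finrank_eq n s, A.finrank_torsion_hom hg (pow_ne_zero n hp) s, ← pow_mul, mul_comm]

/-- **AN ISOMORPHISM ONTO `X[N]` IS A KERNEL OF `[N]`**: for `j : G ⟶ X[N]` an isomorphism, the square `G →(j ≫ ι) X →([N]) X ←(e) S` is CARTESIAN
(★ `isPullback_torsionι` transported along `j`) — with `[N]` written as `(𝟙 X)^N`, the shape of the «torsion tower» predicate `B = X[p^∞]`.
[cite: Tate1967, §2 (2.1) (pp. 161–162)] [cite: GortzWedhorn2020, Definition 4.45 (2)] -/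
theorem isPullback_comp_torsionι_of_isIso {N : ℕ} {G : Over S} (j : G ⟶ A.torsion N) [IsIso j] :
    IsPullback (j ≫ A.torsionι N) (toUnit G) ((𝟙 A.X) ^ N) η[A.X] := by
  have h := A.isPullback_torsionι N
  rw [mulN_def] at h
  have e : toUnit G = j ≫ toUnit (A.torsion N) := toUnit_unique _ _
  rw [e]
  exact IsPullback.of_iso h (asIso j).symm (Iso.refl _) (Iso.refl _) (Iso.refl _) (by simp) (by simp) (by simp) (by simp)

end AbelianSchemeOver

end Literature.AlgebraicGeometry.AbelianSchemes

namespace Literature.AlgebraicGeometry.GroupSchemes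

namespace BTGroup

variable {p h : ℕ}

/-! ## §4 The tower of descended maps `iX n : G n ⟶ X` of a compatible family `β n : G n ⟶ Y` followed by `π : Y ⟶ X` killing `β 2`
(socket E3 «TOWER», descent half: [Katz1981SerreTate] proof of Thm. 1.2.1, «`A[p^∞] ≅ B[p^∞]⧸K`») -/

/-- `incl` and `pMap` commute: `i_{n+1} ≫ j_{n+1} = j_n ≫ i_n` — both composites followed by the monomorphism `i_{n+1}` are `[p]` on `G (n+1)`
pushed into `G (n+2)` (`j ≫ i = [p]`, `i` a homomorphism). [cite: Tate1967, §2 (2.1) (pp. 161–162)] -/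
theorem incl_comp_pMap_eq_pMap_comp_incl {S : Scheme.{u}} (B : BTGroup S p h) (n : ℕ) :
    B.incl (n + 1) ≫ B.pMap (n + 1) = B.pMap n ≫ B.incl n := by
  letI := B.grpObj (n + 1); letI := B.grpObj (n + 1 + 1)
  haveI := B.mono_incl (n + 1)
  haveI := B.incl_isMonHom (n + 1)
  rw [← cancel_mono (B.incl (n + 1)), Category.assoc, Category.assoc, B.pMap_incl (n + 1), reassoc_of% (B.pMap_incl n),
    MonObj.comp_pow, Category.comp_id, MonObj.pow_comp, Category.id_comp]

/-- **THE TOWER OF DESCENDED MAPS** ([Katz1981SerreTate] proof of Thm. 1.2.1, «`A[p^∞] ≅ B[p^∞]⧸K`»; [Tate1967] §2 (2.1)).  `B` a Barsotti–Tate group over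
`S = Spec A`; `β n : G n ⟶ Y` HOMOMORPHISMS into a group scheme `Y`, compatible with `incl`; `π : Y ⟶ X` a homomorphism with `β 2 ≫ π = 1` (i.e. `π`
kills the image of `G 2`).  THEN the maps `β (n+2) ≫ π` DESCEND along `[p²] = pMap (n+1) ≫ pMap n : G (n+2) ↠ G n` to HOMOMORPHISMS `iX n : G n ⟶ X`,
compatible with `incl`, with `pMap (n+1) ≫ pMap n ≫ iX n = β (n+2) ≫ π` and `(iX n)^(pⁿ) = 1`.  Proof: `β (n+2) ≫ π` is constant on the fibres of `[p²]`
(two `T`-points with the same image differ by a point killed by `p²`, i.e. one of `i_{2,n+2}(G 2)` (★ `exists_fac_transition_iff`), on which `β (n+2) = β 2` (★ `transition_comp_family`)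
is killed by `π`); descend by §1; the homomorphism, `incl`-compatibility (`incl ≫ pMap = pMap ≫ incl` twice + uniqueness of descent) and `pⁿ`-torsion
(`(𝟙 (G n))^{pⁿ} = 1`) follow. [cite: Katz1981SerreTate, proof of Theorem 1.2.1 (§1.2, p. 142)] [cite: Tate1967, §2 (2.1) (pp. 161–162)] -/
theorem exists_descTower {A : Type u} [CommRing A] (B : BTGroup (Spec (.of A)) p h) {Y X : Over (Spec (.of A))} [GrpObj Y] [GrpObj X]
    (β : ∀ n, B.G n ⟶ Y) (hβ : ∀ n, letI := B.grpObj n; IsMonHom (β n)) (hβincl : ∀ n, B.incl n ≫ β (n + 1) = β n)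
    (π : Y ⟶ X) [IsMonHom π] (h2 : letI := B.grpObj 2; β 2 ≫ π = 1) :
    ∃ iX : ∀ n, B.G n ⟶ X, (∀ n, letI := B.grpObj n; IsMonHom (iX n)) ∧ (∀ n, B.incl n ≫ iX (n + 1) = iX n) ∧
      (∀ n, B.pMap (n + 1) ≫ B.pMap n ≫ iX n = β (n + 2) ≫ π) ∧ (∀ n, letI := B.grpObj n; iX n ^ (p ^ n) = 1) := by
  -- the characterising equation of `q n := pMap (n+1) ≫ pMap n`
  have hq := B.pMap_succ_comp_pMap_comp_transition
  -- `β (n+2) ≫ π` is constant on the fibres of `q n`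
  have hconst : ∀ n (T : Over (Spec (.of A))) (a b : T ⟶ B.G (n + 1 + 1)),
      a ≫ (B.pMap (n + 1) ≫ B.pMap n) = b ≫ (B.pMap (n + 1) ≫ B.pMap n) → a ≫ (β (n + 2) ≫ π) = b ≫ (β (n + 2) ≫ π) := by
    intro n T a b hab
    letI := B.grpObj n; letI := B.grpObj 2; letI := B.grpObj (n + 1 + 1)
    haveI := B.isMonHom_of_comp_transition_eq_pow (Nat.le_add_right n 2) (hq n)
    haveI := hβ (n + 2)
    -- `a / b` is killed by `q n`, hence by `p²`, hence factors through `i_{2,n+2}`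
    have hdiv : (a / b) ≫ (B.pMap (n + 1) ≫ B.pMap n) = 1 := by rw [GrpObj.div_comp, hab, div_self']
    have hpow : (a / b) ^ (p ^ (n + 2 - n)) = 1 := (B.comp_eq_one_iff_pow_eq_one (Nat.le_add_right n 2) (hq n) _).1 hdiv
    rw [Nat.add_sub_cancel_left] at hpow
    obtain ⟨t, ht⟩ := (B.exists_fac_transition_iff (show 2 ≤ n + 2 from Nat.le_add_left 2 n) (a / b)).2 hpow
    -- … on which `β (n+2) = β 2` is killed by `π`
    have hkill : (a / b) ≫ (β (n + 2) ≫ π) = 1 := by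
      rw [← ht, Category.assoc, ← Category.assoc (B.transition _), B.transition_comp_family β hβincl, h2, MonObj.comp_one]
    rwa [GrpObj.div_comp, div_eq_one] at hkill
  -- descend
  have hdesc := fun n => B.existsUnique_desc_of_comp_transition_eq_pow (Nat.le_add_right n 2) (B.pMap (n + 1) ≫ B.pMap n) (hq n) X
    (β (n + 2) ≫ π) (hconst n)
  choose iX hiX huniq using hdesc
  have hiX' : ∀ n, B.pMap (n + 1) ≫ B.pMap n ≫ iX n = β (n + 2) ≫ π := fun n => by rw [← Category.assoc]; exact hiX n
  -- homomorphisms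
  have hmon : ∀ n, letI := B.grpObj n; IsMonHom (iX n) := by
    intro n
    letI := B.grpObj n; letI := B.grpObj (n + 1 + 1)
    haveI := hβ (n + 2)
    exact B.isMonHom_desc_of_comp_transition_eq_pow (Nat.le_add_right n 2) (hq n) (β (n + 2) ≫ π) inferInstance (iX n) (hiX n)
  refine ⟨iX, hmon, fun n => ?_, hiX', fun n => ?_⟩
  · -- `incl`-compatibility by uniqueness of descent along `q n`: `q n ≫ incl n = incl (n+2) ≫ q (n+1)`
    refine huniq n _ ?_
    have e1 : B.pMap (n + 1) ≫ B.pMap n ≫ B.incl n = B.incl (n + 1 + 1) ≫ B.pMap (n + 1 + 1) ≫ B.pMap (n + 1) := by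
      rw [← B.incl_comp_pMap_eq_pMap_comp_incl n, ← Category.assoc, ← B.incl_comp_pMap_eq_pMap_comp_incl (n + 1), Category.assoc]
    have e2 : B.incl (n + 1 + 1) ≫ β (n + 1 + 2) ≫ π = β (n + 2) ≫ π := by
      rw [← Category.assoc]
      exact congrArg (· ≫ π) (hβincl (n + 2))
    show (B.pMap (n + 1) ≫ B.pMap n) ≫ B.incl n ≫ iX (n + 1) = β (n + 2) ≫ π
    calc (B.pMap (n + 1) ≫ B.pMap n) ≫ B.incl n ≫ iX (n + 1) = (B.pMap (n + 1) ≫ B.pMap n ≫ B.incl n) ≫ iX (n + 1) := by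
          simp only [Category.assoc]
      _ = (B.incl (n + 1 + 1) ≫ B.pMap (n + 1 + 1) ≫ B.pMap (n + 1)) ≫ iX (n + 1) := by rw [e1]
      _ = B.incl (n + 1 + 1) ≫ β (n + 1 + 2) ≫ π := by simp only [Category.assoc, hiX' (n + 1)]
      _ = β (n + 2) ≫ π := e2
  · -- killed by `pⁿ`
    letI := B.grpObj n
    haveI := hmon n
    calc iX n ^ (p ^ n) = ((𝟙 (B.G n)) ≫ iX n) ^ (p ^ n) := by rw [Category.id_comp]
      _ = ((𝟙 (B.G n)) ^ (p ^ n)) ≫ iX n := (MonObj.pow_comp _ _ _).symm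
      _ = 1 := by rw [B.killed n, MonObj.one_comp]

/-- **SOCKET E3 «TOWER», DESCENT HALF, IN THE SOCKET'S OWN BINDERS** (the sub-line stub `F0P6bSigma2TowerOfQuotient.stub_E3D_descentAlongPSq` of
`Cruxes/HLiu418/Lines`, VERBATIM except that the `Lines`-side predicate `F0P6bBTSerreTateDefs.IsTorsionTower X₀ B₀ i₀` is spelled by its body — a Literature
file cannot import it; the two statements are δ-convertible).  Every binder but `B`, `β`, its two laws, `b ≫ iZ = β 2`, `π` and the kernel clause
`u ≫ π = 1 ↔ ∃ v, v ≫ iZ = u` (at `u := iZ`: `iZ ≫ π = 1`, so `β 2 ≫ π = b ≫ iZ ≫ π = 1`) is idle: this is ★ `exists_descTower`.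
[cite: Katz1981SerreTate, proof of Theorem 1.2.1 (§1.2, p. 142)] [cite: Tate1967, §2 (2.1) (pp. 161–162)] -/
theorem descTower_sigma2 :
    ∀ (p : ℕ), p.Prime → ∀ (A : Type) [CommRing A] [IsArtinianRing A] [IsLocalRing A], IsNilpotent (p : A) →
      ∀ (J : Ideal A), J ≠ ⊤ → IsLocalRing.maximalIdeal A * J = ⊥ →
      ∀ (g : ℕ) (X₀ : AbelianSchemes.AbelianSchemeOver (Spec (.of (A ⧸ J)))), X₀.IsOfRelDim g →
      ∀ (B₀ : BTGroup (Spec (.of (A ⧸ J))) p (2 * g)) (i₀ : ∀ n, B₀.G n ⟶ X₀.X),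
        ((∀ n, letI := B₀.grpObj n; IsMonHom (i₀ n)) ∧
          (∀ n, IsPullback (i₀ n) (toUnit (B₀.G n)) (((𝟙 X₀.X : X₀.X ⟶ X₀.X) ^ (p ^ n) : X₀.X ⟶ X₀.X)) η[X₀.X]) ∧
          (∀ n, B₀.incl n ≫ i₀ (n + 1) = i₀ n)) →
      ∀ (B : BTGroup (Spec (.of A)) p (2 * g)) (c : ∀ n, (B₀.G n).left ⟶ (B.G n).left),
        B₀.IsBaseChangeVia B (Spec.map (CommRingCat.ofHom (Ideal.Quotient.mk J))) c →
      ∀ (Y : AbelianSchemes.AbelianSchemeOver (Spec (.of A))), Y.IsOfRelDim g → ∀ (GY : X₀.X.left ⟶ Y.X.left),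
        X₀.IsBaseChangeVia Y (Spec.map (CommRingCat.ofHom (Ideal.Quotient.mk J))) GY →
      ∀ (β : ∀ n, B.G n ⟶ Y.X), (∀ n, letI := B.grpObj n; IsMonHom (β n)) → (∀ n, B.incl n ≫ β (n + 1) = β n) →
        (∀ n, c n ≫ (β n).left = ((i₀ n) ^ p).left ≫ GY) →
      ∀ (Z : Over (Spec (.of A))) (iZ : Z ⟶ Y.X) (b : B.G 2 ⟶ Z), IsClosedImmersion iZ.left → IsFinite Z.hom → Flat Z.hom →
        b ≫ iZ = β 2 → Flat b.left → Surjective b.left →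
      ∀ (X : AbelianSchemes.AbelianSchemeOver (Spec (.of A))), X.IsOfRelDim g → ∀ (π : Y.X ⟶ X.X), IsMonHom π → IsFinite π.left → Flat π.left →
        Surjective π.left → (∀ (T : Over (Spec (.of A))) (u : T ⟶ Y.X), u ≫ π = 1 ↔ ∃ v : T ⟶ Z, v ≫ iZ = u) →
        ∃ iX : ∀ n, B.G n ⟶ X.X, (∀ n, letI := B.grpObj n; IsMonHom (iX n)) ∧ (∀ n, B.incl n ≫ iX (n + 1) = iX n) ∧
          (∀ n, B.pMap (n + 1) ≫ B.pMap n ≫ iX n = β (n + 2) ≫ π) ∧ (∀ n, letI := B.grpObj n; iX n ^ (p ^ n) = 1) := by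
  intro p _ A _ _ _ _ J _ _ g X₀ _ B₀ i₀ _ B c _ Y _ GY _ β hβ hβincl _ Z iZ b _ _ _ hbZ _ _ X _ π hπ _ _ _ hker
  letI := B.grpObj 2
  haveI := hπ
  have hiZπ : iZ ≫ π = 1 := (hker Z iZ).2 ⟨𝟙 Z, Category.id_comp _⟩
  have h2 : β 2 ≫ π = 1 := by rw [← hbZ, Category.assoc, hiZπ, MonObj.comp_one]
  exact B.exists_descTower β hβ hβincl π h2

end BTGroup

end Literature.AlgebraicGeometry.GroupSchemes

end
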